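import Mathlib
import Summits.KontsevichZagierPeriods.Zeta5Search.Families.CoeffAsympMinimizer
import HarnessLib

/-!
# ζ(5) search — Families: coefficient asymptotics of powers of a positive polynomial, VIII — the minimum on the face
# IS the infimum of the full tilt

HONEST FRAMING: systematic search; no irrationality claim unless certified.  Cell `pub-zeta5`, certifier 2
(cert-2 g9, 2026-08-22).  Elementary convex geometry (finite-dimensional Hahn–Banach separation); no conjecture node
is used; nothing about `ζ(5)`; no number of record moves.

**`iInf_tilt_eq_tilt_face_min`** — for `c > 0` on `S`, `B ∈ S` and a minimiser `u₀` of the tilt on the face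
`F = face S B` (`Families/CoeffAsympMinimizer`):  `⨅_u Σ_{α ∈ S} c_α e^{(α−B)·u} = Σ_{α ∈ F} c_α e^{(α−B)·u₀}`.
`≥` is termwise.  `≤`: the convex hull of `{α − B : α ∈ S ∖ F}` is disjoint from the linear span `Z` of `{α − B : α ∈ F}`
(a common point would be a non-negative relation carrying a monomial off the face), so Hahn–Banach gives a linear
functional `λ` vanishing on `Z` and negative on every `α − B`, `α ∉ F` (`exists_exposing`); along `u₀ + sλ` the face terms
are constant and the others tend to `0`.  Standard axioms only.
-/

noncomputable section

open Finset Real Filter Topology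

namespace Summit.KontsevichZagierPeriods.Zeta5Search.Families.Cellular

namespace CoeffAsymp

variable {d : ℕ}

/-- `α ↦ α − B` is injective. -/
theorem dvec_injective (B : Fin d →₀ ℕ) : Function.Injective (dvec B) := by
  intro α β h
  ext i
  have := congrFun h i
  simp only [dvec, sub_left_inj, Nat.cast_inj] at this
  exact this

/-- A continuous linear functional on `ℝ^d` is the dot product with the vector of its values on the basis. -/
theorem clm_apply_eq_dot (f : (Fin d → ℝ) →L[ℝ] ℝ) (B α : Fin d →₀ ℕ) :
    f (dvec B α) = dot B α (fun i => f (Pi.single i 1)) := by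
  classical
  unfold dot
  conv_lhs => rw [pi_eq_sum_univ' (dvec B α)]
  rw [map_sum]
  refine Finset.sum_congr rfl fun i _ => ?_
  rw [map_smul, smul_eq_mul]

/-- A point common to the convex hull of `{α − B : α ∈ S ∖ face}` and the span of `{α − B : α ∈ face}` would be a
non-negative relation carrying a monomial off the face: the two sets are disjoint. -/
theorem disjoint_hull_span (S : Finset (Fin d →₀ ℕ)) (B : Fin d →₀ ℕ) :
    Disjoint (convexHull ℝ (((S \ face S B).image (dvec B) : Finset (Fin d → ℝ)) : Set (Fin d → ℝ)))
      ((Submodule.span ℝ (((face S B).image (dvec B) : Finset (Fin d → ℝ)) : Set (Fin d → ℝ)) :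
        Submodule ℝ (Fin d → ℝ)) : Set (Fin d → ℝ)) := by
  classical
  obtain ⟨μ, hμrel, hμpos, hμzero⟩ := exists_pos_relation S B
  rw [Set.disjoint_left]
  intro x hxG hxZ
  obtain ⟨w, hw0, hw1, hwx⟩ := Finset.mem_convexHull'.1 hxG
  obtain ⟨r, -, hrx⟩ := Submodule.mem_span_finset.1 hxZ
  -- transfer the sums over vectors to sums over monomials
  have hwx' : ∑ α ∈ S \ face S B, w (dvec B α) • dvec B α = x := by
    rw [← hwx, Finset.sum_image fun α _ β _ h => dvec_injective B h]
  have hrx' : ∑ α ∈ face S B, r (dvec B α) • dvec B α = x := by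
    rw [← hrx, Finset.sum_image fun α _ β _ h => dvec_injective B h]
  have hw1' : ∑ α ∈ S \ face S B, w (dvec B α) = 1 := by
    rw [← hw1, Finset.sum_image fun α _ β _ h => dvec_injective B h]
  have hw0' : ∀ α ∈ S \ face S B, 0 ≤ w (dvec B α) := fun α hα => hw0 _ (Finset.mem_image_of_mem _ hα)
  -- some monomial off the face carries positive weight
  obtain ⟨α₀, hα₀, hwα₀⟩ : ∃ α₀ ∈ S \ face S B, 0 < w (dvec B α₀) := by
    by_contra h
    simp only [not_exists, not_and, not_lt] at h
    have : ∑ α ∈ S \ face S B, w (dvec B α) ≤ 0 := Finset.sum_nonpos h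
    linarith
  have hα₀S : α₀ ∈ S := (Finset.mem_sdiff.1 hα₀).1
  have hα₀F : α₀ ∉ face S B := (Finset.mem_sdiff.1 hα₀).2
  -- a multiplier `t` with `r ≤ t μ` on the face
  obtain ⟨t, htμ⟩ : ∃ t : ℝ, ∀ β ∈ face S B, r (dvec B β) ≤ t * μ β := by
    refine ⟨∑ β ∈ face S B, |r (dvec B β)| / μ β, fun β hβ => ?_⟩
    have hμβ := hμpos β hβ
    have h1 : |r (dvec B β)| / μ β ≤ ∑ γ ∈ face S B, |r (dvec B γ)| / μ γ :=
      Finset.single_le_sum (f := fun γ => |r (dvec B γ)| / μ γ)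
        (fun γ hγ => div_nonneg (abs_nonneg _) (hμpos γ hγ).le) hβ
    have h2 : |r (dvec B β)| ≤ (∑ γ ∈ face S B, |r (dvec B γ)| / μ γ) * μ β := by
      rw [← div_le_iff₀ hμβ]; exact h1
    linarith [le_abs_self (r (dvec B β))]
  -- the combined relation `ρ = t μ − r` on the face, `w` off the face
  set ρ : (Fin d →₀ ℕ) → ℝ := fun β => if β ∈ face S B then t * μ β - r (dvec B β) else w (dvec B β) with hρ
  have hρ_nonneg : ∀ β ∈ S, 0 ≤ ρ β := by
    intro β hβ
    simp only [hρ]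
    split_ifs with hβF
    · linarith [htμ β hβF]
    · exact hw0' β (Finset.mem_sdiff.2 ⟨hβ, hβF⟩)
  have hρ_rel : ∀ i, ∑ β ∈ S, ρ β * dvec B β i = 0 := by
    intro i
    have hsplit : ∑ β ∈ S, ρ β * dvec B β i =
        ∑ β ∈ face S B, (t * μ β - r (dvec B β)) * dvec B β i +
          ∑ β ∈ S \ face S B, w (dvec B β) * dvec B β i := by
      rw [← Finset.sum_sdiff (face_subset S B), add_comm]
      congr 1
      · exact Finset.sum_congr rfl fun β hβ => by simp [hρ, hβ]
      · exact Finset.sum_congr rfl fun β hβ => by simp [hρ, (Finset.mem_sdiff.1 hβ).2]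
    have h1 : ∑ β ∈ face S B, (t * μ β - r (dvec B β)) * dvec B β i =
        t * ∑ β ∈ face S B, μ β * dvec B β i - ∑ β ∈ face S B, r (dvec B β) * dvec B β i := by
      rw [Finset.mul_sum, ← Finset.sum_sub_distrib]
      exact Finset.sum_congr rfl fun β _ => by ring
    have h2 : ∑ β ∈ face S B, μ β * dvec B β i = 0 := by
      rw [← hμrel.2 i]
      exact Finset.sum_subset (face_subset S B) fun β hβS hβF => by rw [hμzero β hβS hβF, zero_mul]
    have h3 : ∑ β ∈ face S B, r (dvec B β) * dvec B β i = x i := by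
      have := congrFun hrx' i
      simpa [Finset.sum_apply, Pi.smul_apply, smul_eq_mul] using this
    have h4 : ∑ β ∈ S \ face S B, w (dvec B β) * dvec B β i = x i := by
      have := congrFun hwx' i
      simpa [Finset.sum_apply, Pi.smul_apply, smul_eq_mul] using this
    rw [hsplit, h1, h2, h3, h4]; ring
  have hmem : α₀ ∈ face S B := by
    refine mem_face.2 ⟨hα₀S, ρ, ⟨hρ_nonneg, hρ_rel⟩, ?_⟩
    simp only [hρ, hα₀F, if_false]
    exact hwα₀
  exact hα₀F hmem

/-- A linear functional bounded below on a subspace vanishes there. -/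
theorem clm_eq_zero_of_lt {Z : Submodule ℝ (Fin d → ℝ)} (f : (Fin d → ℝ) →L[ℝ] ℝ) {v : ℝ}
    (hv : ∀ z ∈ (Z : Set (Fin d → ℝ)), v < f z) : ∀ z ∈ Z, f z = 0 := by
  intro z hz
  by_contra hne
  have hmem : ((v - 1) / f z) • z ∈ (Z : Set (Fin d → ℝ)) := Z.smul_mem _ hz
  have := hv _ hmem
  rw [map_smul, smul_eq_mul, div_mul_cancel₀ _ hne] at this
  linarith

/-- **The exposing functional.**  There is `λ ∈ ℝ^d` with `(α − B)·λ = 0` for `α ∈ face S B` and `(α − B)·λ < 0` for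
`α ∈ S ∖ face S B`. -/
theorem exists_exposing (S : Finset (Fin d →₀ ℕ)) (B : Fin d →₀ ℕ) :
    ∃ lam : Fin d → ℝ, (∀ α ∈ face S B, dot B α lam = 0) ∧ (∀ α ∈ S, α ∉ face S B → dot B α lam < 0) := by
  classical
  have hs_cpt : IsCompact (convexHull ℝ (((S \ face S B).image (dvec B) : Finset (Fin d → ℝ)) : Set (Fin d → ℝ))) :=
    (Finset.finite_toSet _).isCompact_convexHull (𝕜 := ℝ)
  have hs_cvx : Convex ℝ (convexHull ℝ (((S \ face S B).image (dvec B) : Finset (Fin d → ℝ)) : Set (Fin d → ℝ))) :=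
    convex_convexHull ℝ _
  have ht_closed : IsClosed ((Submodule.span ℝ (((face S B).image (dvec B) : Finset (Fin d → ℝ)) :
      Set (Fin d → ℝ)) : Submodule ℝ (Fin d → ℝ)) : Set (Fin d → ℝ)) := Submodule.closed_of_finiteDimensional _
  have ht_cvx : Convex ℝ ((Submodule.span ℝ (((face S B).image (dvec B) : Finset (Fin d → ℝ)) :
      Set (Fin d → ℝ)) : Submodule ℝ (Fin d → ℝ)) : Set (Fin d → ℝ)) := Submodule.convex _
  obtain ⟨f, u, v, hfu, huv, hfv⟩ :=
    geometric_hahn_banach_compact_closed hs_cvx hs_cpt ht_cvx ht_closed (disjoint_hull_span S B)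
  have hfZ := clm_eq_zero_of_lt f hfv
  have hv0 : v < 0 := by simpa using hfv 0 (Submodule.zero_mem _)
  refine ⟨fun i => f (Pi.single i 1), fun α hα => ?_, fun α hαS hαF => ?_⟩
  · rw [← clm_apply_eq_dot]
    refine hfZ _ (Submodule.subset_span ?_)
    simp only [Finset.coe_image, Set.mem_image, Finset.mem_coe]
    exact ⟨α, hα, rfl⟩
  · rw [← clm_apply_eq_dot]
    have hmem : dvec B α ∈ convexHull ℝ (((S \ face S B).image (dvec B) : Finset (Fin d → ℝ)) : Set (Fin d → ℝ)) := by
      refine subset_convexHull ℝ _ ?_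
      simp only [Finset.coe_image, Set.mem_image, Finset.mem_coe]
      exact ⟨α, Finset.mem_sdiff.2 ⟨hαS, hαF⟩, rfl⟩
    linarith [hfu _ hmem]

/-- `(α − B)·(u + s λ) = (α − B)·u + s (α − B)·λ`. -/
theorem dot_add_smul (B α : Fin d →₀ ℕ) (u lam : Fin d → ℝ) (s : ℝ) :
    dot B α (u + s • lam) = dot B α u + s * dot B α lam := by
  rw [← dotLin_apply, map_add, map_smul, smul_eq_mul, dotLin_apply, dotLin_apply]

/-- **The minimum on the face is the infimum of the full tilt.** -/
theorem iInf_tilt_eq_tilt_face_min {S : Finset (Fin d →₀ ℕ)} {c : (Fin d →₀ ℕ) → ℝ} (hc : ∀ α ∈ S, 0 < c α)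
    {B : Fin d →₀ ℕ} {u₀ : Fin d → ℝ} (hmin : ∀ u, tilt (face S B) c B u₀ ≤ tilt (face S B) c B u) :
    ⨅ u : Fin d → ℝ, tilt S c B u = tilt (face S B) c B u₀ := by
  classical
  set F := face S B with hF
  have hFS : F ⊆ S := face_subset S B
  -- `≥`
  have hge : ∀ u, tilt F c B u₀ ≤ tilt S c B u := fun u =>
    le_trans (hmin u) (Finset.sum_le_sum_of_subset_of_nonneg hFS fun α hα _ =>
      (mul_pos (hc α hα) (Real.exp_pos _)).le)
  have hbdd : BddBelow (Set.range fun u : Fin d → ℝ => tilt S c B u) := ⟨tilt F c B u₀, by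
    rintro _ ⟨u, rfl⟩; exact hge u⟩
  refine le_antisymm ?_ (le_ciInf hge)
  -- `≤` along the exposing direction
  obtain ⟨lam, hlamF, hlamS⟩ := exists_exposing S B
  have hsplit : ∀ s : ℝ, tilt S c B (u₀ + s • lam) =
      tilt F c B u₀ + ∑ α ∈ S \ F, c α * Real.exp (dot B α u₀) * Real.exp (s * dot B α lam) := by
    intro s
    unfold tilt
    rw [← Finset.sum_sdiff hFS, add_comm]
    congr 1
    · refine Finset.sum_congr rfl fun α hα => ?_
      rw [dot_add_smul, hlamF α hα, mul_zero, add_zero]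
    · refine Finset.sum_congr rfl fun α _ => ?_
      rw [dot_add_smul, Real.exp_add, mul_assoc]
  have hlim : Tendsto (fun s : ℝ => tilt S c B (u₀ + s • lam)) atTop (𝓝 (tilt F c B u₀)) := by
    have h2 : Tendsto (fun s : ℝ => ∑ α ∈ S \ F, c α * Real.exp (dot B α u₀) * Real.exp (s * dot B α lam)) atTop
        (𝓝 (∑ α ∈ S \ F, (0 : ℝ))) := by
      refine tendsto_finsetSum _ fun α hα => ?_
      have hneg := hlamS α (Finset.mem_sdiff.1 hα).1 (Finset.mem_sdiff.1 hα).2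
      have h1 : Tendsto (fun s : ℝ => Real.exp (s * dot B α lam)) atTop (𝓝 0) :=
        Real.tendsto_exp_atBot.comp (tendsto_id.atTop_mul_const_of_neg hneg)
      simpa using h1.const_mul (c α * Real.exp (dot B α u₀))
    rw [Finset.sum_const_zero] at h2
    have h3 := (tendsto_const_nhds (x := tilt F c B u₀)).add h2
    rw [add_zero] at h3
    exact h3.congr fun s => (hsplit s).symm
  refine le_of_forall_pos_lt_add fun η hη => ?_
  have hev := hlim.eventually (gt_mem_nhds (lt_add_of_pos_right _ hη))
  obtain ⟨s, hs⟩ := hev.exists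
  exact lt_of_le_of_lt (ciInf_le hbdd (u₀ + s • lam)) hs

end CoeffAsymp

end Summit.KontsevichZagierPeriods.Zeta5Search.Families.Cellular
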